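import Summits.AnomalousDissipation.AnomalousDissipation.Theorems.SawtoothPulseCascadeK1LocalisedCascadeNToothOffLobe

/-!
# K1loc explicit start — helper: OFF-LOBE WINDOW MASSES OF A (ROUNDED) `N`-TOOTH CHIRP («TwoToothOffLobe», dischargers j_V / j_O)

Helper file of the prover lane on the crux `K1LocalisedCascade` (stmt-AnomalousDissipation-19491), route `SawtoothPulseCascade`
(arbiter A24-5 R1).  Continues `NToothOffLobe`:
* `sum_inside_sq_norm_nTooth_le'`: the UNIFORM inside bound `Σ_{|m| ≤ |λ|−NE} ‖ĝ₀(m)‖² ≤ 4/(π²(E−1))` (partial fractions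
  `2|L|/(L²−j²) = 1/(|L|−j) + 1/(|L|+j)` and the telescoping tail);
* **`sum_offLobe_window_sq_norm_nTooth_le`**: for a finite window `W` at distance `≥ NE` from both lobes,
  `Σ_{m∈W} ‖ĝ₀(m)‖² ≤ 6/(π²(E−1))`;
* **`sum_offLobe_window_sq_norm_twist_le`**: the same window, shifted by a source offset `|q'| ≤ Q` and for a rounded chirp
  `g = twist ψ n` with `|nψ − f| ≤ η` (`g₀ = e^{−2πif}`): `Σ_{m∈W} ‖ĝ(m−q')‖² ≤ (√(6/(π²(E−1))) + 2πη)²` whenever `W` keeps distance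
  `≥ NE + Q` from the lobes.
No definitions; nothing about the crux. [cite: Grafakos2014, Prop. 3.1.2 (5), Prop. 3.2.7 (3)] [problem: turb]
-/

-- `Summit.<Summit>.<Problem>`: single-conjunct summit, the duplicate namespace segment is deliberate.
set_option linter.dupNamespace false

noncomputable section

namespace Summit.AnomalousDissipation.AnomalousDissipation.Theorems.SawtoothPulseCascade.K1Window

open MeasureTheory Filter Topology UnitAddTorus Complex AddCircle
open scoped Real
open Literature.Analysis Literature.Analysis.FunctionSpaces Literature.Analysis.FunctionSpaces.Torus Literature.Analysis.FluidPDE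
open Literature.Analysis.FluidPDE.ShearStage Literature.Analysis.FluidPDE.SawtoothCascade
open Summit.AnomalousDissipation.AnomalousDissipation.Theorems.SawtoothPulseCascade.K1Start

/-! ## §1 The uniform inside bound -/

/-- `Σ_{j ∈ [−K, K]} 1/(|L|−j)² ≤ 1/(E−1)` for `K = |L| − E`, `E ≥ 2`. [folklore] -/
theorem sum_Icc_inv_sq_reflect_le {L : ℤ} {E : ℕ} (hE : 2 ≤ E) (hEL : (E : ℤ) ≤ |L|) :
    ∑ j ∈ Finset.Icc (-(|L| - E)) (|L| - E), 1 / ((|(L : ℝ)| - j) ^ 2) ≤ 1 / ((E : ℝ) - 1) := by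
  -- reindex `j = |L| − E − e`, `e ∈ range (2(|L|−E)+1)`, so that `|L| − j = E + e`
  set K : ℤ := |L| - E with hK
  have hK0 : 0 ≤ K := by rw [hK]; linarith
  have hLr : ((|L| : ℤ) : ℝ) = |(L : ℝ)| := by push_cast; rfl
  have himg : Finset.Icc (-K) K = (Finset.range (2 * K + 1).toNat).image (fun e : ℕ => K - (e : ℤ)) := by
    ext j
    simp only [Finset.mem_Icc, Finset.mem_image, Finset.mem_range]
    constructor
    · intro h
      refine ⟨(K - j).toNat, ?_, by omega⟩
      have : ((K - j).toNat : ℤ) < (((2 * K + 1).toNat : ℕ) : ℤ) := by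
        rw [Int.toNat_of_nonneg (by omega), Int.toNat_of_nonneg (by omega)]; omega
      exact_mod_cast this
    · rintro ⟨e, he, rfl⟩
      have : ((e : ℕ) : ℤ) < (((2 * K + 1).toNat : ℕ) : ℤ) := by exact_mod_cast he
      rw [Int.toNat_of_nonneg (by omega)] at this
      omega
  rw [himg, Finset.sum_image fun a _ b _ h => by simpa using h]
  have e1 : ∀ e : ℕ, 1 / ((|(L : ℝ)| - ((K - (e : ℤ) : ℤ) : ℝ)) ^ 2) = 1 / (((E : ℝ) + e) ^ 2) := by
    intro e
    rw [hK]; push_cast; rw [← hLr]; push_cast; ring_nf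
  simp_rw [e1]
  refine (sum_range_inv_sq_shift_le hE _).trans ?_
  have hE' : (2 : ℝ) ≤ E := by exact_mod_cast hE
  have : (0 : ℝ) < (E : ℝ) + ((2 * K + 1).toNat : ℕ) - 1 := by
    have : (0 : ℝ) ≤ ((2 * K + 1).toNat : ℕ) := Nat.cast_nonneg _; linarith
  have : 0 ≤ 1 / ((E : ℝ) + ((2 * K + 1).toNat : ℕ) - 1) := by positivity
  linarith

/-- **Uniform inside bound**: for `λ = N·L`, `2 ≤ E ≤ |L|`,
`Σ_{|m| ≤ |λ|−NE} ‖ĝ₀(m)‖² ≤ 4/(π²(E−1))`. [cite: Grafakos2014, Prop. 3.1.2 (5)] -/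
theorem sum_inside_sq_norm_nTooth_le' {N : ℕ} (hN : 0 < N) {lam L : ℤ} (hL : lam = N * L) {g₀ : UnitAddCircle → ℂ}
    (hg₀ : ∀ t : ℝ, g₀ (t : UnitAddCircle) = Complex.exp (-(2 * π * I * lam * ((tri (2 * π * N * t) / (2 * π * N) : ℝ) : ℂ))))
    {E : ℕ} (hE : 2 ≤ E) (hEL : (E : ℤ) ≤ |L|) :
    ∑ m ∈ Finset.Icc (-(|lam| - (N : ℤ) * E)) (|lam| - (N : ℤ) * E), ‖fourierCoeff g₀ m‖ ^ 2 ≤ 4 / (π ^ 2 * ((E : ℝ) - 1)) := by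
  classical
  have hπ : 0 < π := Real.pi_pos
  have hNz : (0 : ℤ) < N := by exact_mod_cast hN
  have hNr : (0 : ℝ) < N := by exact_mod_cast hN
  have hE' : (2 : ℝ) ≤ E := by exact_mod_cast hE
  have hlam : |lam| = (N : ℤ) * |L| := by rw [hL, abs_mul, Nat.abs_cast]
  set M : ℤ := |lam| - (N : ℤ) * E with hM
  have hMN : M = (N : ℤ) * (|L| - E) := by rw [hM, hlam]; ring
  set S : Finset ℤ := (Finset.Icc (-(|L| - E)) (|L| - E)).image (fun j => (N : ℤ) * j) with hS
  have hSsub : S ⊆ Finset.Icc (-M) M := by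
    intro m hm
    rw [hS, Finset.mem_image] at hm
    obtain ⟨j, hj, rfl⟩ := hm
    rw [Finset.mem_Icc] at hj ⊢
    rw [hMN]; constructor <;> nlinarith
  have hzero : ∀ m ∈ Finset.Icc (-M) M, m ∉ S → ‖fourierCoeff g₀ m‖ ^ 2 = 0 := by
    intro m hm hmS
    rw [Finset.mem_Icc] at hm
    have hd : ¬ (N : ℤ) ∣ m := by
      rintro ⟨j, rfl⟩
      apply hmS
      rw [hS, Finset.mem_image]
      refine ⟨j, Finset.mem_Icc.2 ⟨?_, ?_⟩, rfl⟩ <;> nlinarith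
    have hm' : |m| ≠ |lam| := by
      have : (1 : ℤ) ≤ (N : ℤ) * E := by nlinarith [show (2 : ℤ) ≤ E by exact_mod_cast hE]
      have : |m| ≤ M := abs_le.2 hm
      omega
    simp [fourierCoeff_nTooth_eq_zero_of_not_dvd hN lam hg₀ hm' hd]
  rw [← Finset.sum_subset hSsub (fun m hm hmS => hzero m hm hmS), hS,
    Finset.sum_image fun a _ b _ h => mul_left_cancel₀ hNz.ne' h]
  -- termwise: `‖ĝ₀(Nj)‖² ≤ (2/π²)(1/(|L|−j)² + 1/(|L|+j)²)`
  have hLr : ((|L| : ℤ) : ℝ) = |(L : ℝ)| := by push_cast; rfl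
  have hEL' : (E : ℝ) ≤ |(L : ℝ)| := by
    have : ((E : ℤ) : ℝ) ≤ ((|L| : ℤ) : ℝ) := by exact_mod_cast hEL
    push_cast at this; exact this
  have hterm : ∀ j ∈ Finset.Icc (-(|L| - E)) (|L| - E), ‖fourierCoeff g₀ ((N : ℤ) * j)‖ ^ 2 ≤
      2 / π ^ 2 * (1 / ((|(L : ℝ)| - j) ^ 2) + 1 / ((|(L : ℝ)| + j) ^ 2)) := by
    intro j hj
    rw [Finset.mem_Icc] at hj
    have hjr : -(|(L : ℝ)| - E) ≤ (j : ℝ) ∧ (j : ℝ) ≤ |(L : ℝ)| - E := by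
      constructor
      · have : ((-(|L| - E) : ℤ) : ℝ) ≤ (j : ℝ) := by exact_mod_cast hj.1
        push_cast at this; exact this
      · have : (j : ℝ) ≤ ((|L| - E : ℤ) : ℝ) := by exact_mod_cast hj.2
        push_cast at this; exact this
    have ha : 0 < |(L : ℝ)| - j := by linarith
    have hb : 0 < |(L : ℝ)| + j := by linarith
    have hin : |(N : ℤ) * j| < |lam| := by
      rw [abs_mul, Nat.abs_cast, hlam]
      have : (1 : ℤ) ≤ E := by linarith
      have hj' : |j| ≤ |L| - E := abs_le.2 hj
      nlinarith
    have h := norm_fourierCoeff_nTooth_le_inside hN lam hg₀ hin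
    rw [if_pos (dvd_mul_right _ _)] at h
    have e : 2 * (N : ℝ) * |(lam : ℝ)| / (π * (((lam : ℝ)) ^ 2 - ((((N : ℤ) * j : ℤ)) : ℝ) ^ 2)) =
        1 / π * (1 / (|(L : ℝ)| - j) + 1 / (|(L : ℝ)| + j)) := by
      have hlamr : |(lam : ℝ)| = (N : ℝ) * |(L : ℝ)| := by rw [hL]; push_cast; rw [abs_mul, Nat.abs_cast]
      have hlam2 : ((lam : ℝ)) ^ 2 = (N : ℝ) ^ 2 * |(L : ℝ)| ^ 2 := by rw [← sq_abs, hlamr]; ring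
      have hne : |(L : ℝ)| ^ 2 - (j : ℝ) ^ 2 ≠ 0 := by
        have : |(L : ℝ)| ^ 2 - (j : ℝ) ^ 2 = (|(L : ℝ)| - j) * (|(L : ℝ)| + j) := by ring
        rw [this]; exact (mul_pos ha hb).ne'
      have hne2 : (N : ℝ) ^ 2 * |(L : ℝ)| ^ 2 - (N : ℝ) ^ 2 * (j : ℝ) ^ 2 ≠ 0 := by
        rw [← mul_sub]; exact mul_ne_zero (by positivity) hne
      rw [hlam2, hlamr]; push_cast
      rw [show ((N : ℝ) * j) ^ 2 = (N : ℝ) ^ 2 * (j : ℝ) ^ 2 by ring]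
      rw [div_add_div _ _ ha.ne' hb.ne', div_eq_iff (mul_ne_zero hπ.ne' hne2)]
      field_simp
      ring
    rw [e] at h
    calc ‖fourierCoeff g₀ ((N : ℤ) * j)‖ ^ 2 ≤ (1 / π * (1 / (|(L : ℝ)| - j) + 1 / (|(L : ℝ)| + j))) ^ 2 :=
          pow_le_pow_left₀ (norm_nonneg _) h 2
      _ ≤ 2 / π ^ 2 * (1 / ((|(L : ℝ)| - j) ^ 2) + 1 / ((|(L : ℝ)| + j) ^ 2)) := by
          rw [mul_pow, div_pow, one_pow]
          have : (1 / (|(L : ℝ)| - j) + 1 / (|(L : ℝ)| + j)) ^ 2 ≤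
              2 * (1 / ((|(L : ℝ)| - j) ^ 2) + 1 / ((|(L : ℝ)| + j) ^ 2)) := by
            have key : ∀ x y : ℝ, (x + y) ^ 2 ≤ 2 * (x ^ 2 + y ^ 2) := fun x y => by nlinarith [sq_nonneg (x - y)]
            have h := key (1 / (|(L : ℝ)| - j)) (1 / (|(L : ℝ)| + j))
            rwa [one_div_pow, one_div_pow] at h
          have hπ2 : 0 < 1 / π ^ 2 := by positivity
          calc 1 / π ^ 2 * (1 / (|(L : ℝ)| - j) + 1 / (|(L : ℝ)| + j)) ^ 2
              ≤ 1 / π ^ 2 * (2 * (1 / ((|(L : ℝ)| - j) ^ 2) + 1 / ((|(L : ℝ)| + j) ^ 2))) :=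
                mul_le_mul_of_nonneg_left this hπ2.le
            _ = 2 / π ^ 2 * (1 / ((|(L : ℝ)| - j) ^ 2) + 1 / ((|(L : ℝ)| + j) ^ 2)) := by ring
  refine (Finset.sum_le_sum hterm).trans ?_
  rw [← Finset.mul_sum, Finset.sum_add_distrib]
  have h1 := sum_Icc_inv_sq_reflect_le (L := L) hE hEL
  -- the reflected sum equals the direct one (`j ↦ −j`)
  have h2 : ∑ j ∈ Finset.Icc (-(|L| - E)) (|L| - E), 1 / ((|(L : ℝ)| + j) ^ 2) =
      ∑ j ∈ Finset.Icc (-(|L| - E)) (|L| - E), 1 / ((|(L : ℝ)| - j) ^ 2) := by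
    refine Finset.sum_equiv (Equiv.neg ℤ) (fun j => ?_) (fun j _ => ?_)
    · simp only [Equiv.neg_apply, Finset.mem_Icc]; omega
    · simp only [Equiv.neg_apply]; push_cast; ring
  rw [h2]
  have hπ2 : 0 ≤ 2 / π ^ 2 := by positivity
  calc 2 / π ^ 2 * (∑ j ∈ Finset.Icc (-(|L| - (E : ℤ))) (|L| - E), 1 / ((|(L : ℝ)| - j) ^ 2) +
        ∑ j ∈ Finset.Icc (-(|L| - (E : ℤ))) (|L| - E), 1 / ((|(L : ℝ)| - j) ^ 2))
      ≤ 2 / π ^ 2 * (1 / ((E : ℝ) - 1) + 1 / ((E : ℝ) - 1)) := mul_le_mul_of_nonneg_left (add_le_add h1 h1) hπ2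
    _ = 4 / (π ^ 2 * ((E : ℝ) - 1)) := by field_simp; ring

/-! ## §2 Finite windows away from both lobes -/

/-- **Off-lobe window mass of the exact chirp**: for `λ = N·L`, `E ≥ 2` and a finite window `W` with
`NE ≤ ||m| − |λ||` on `W`, `Σ_{m∈W} ‖ĝ₀(m)‖² ≤ 6/(π²(E−1))`. [cite: Grafakos2014, Prop. 3.1.2 (5), Prop. 3.2.7 (3)] -/
theorem sum_offLobe_window_sq_norm_nTooth_le {N : ℕ} (hN : 0 < N) {lam L : ℤ} (hL : lam = N * L) {g₀ : UnitAddCircle → ℂ}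
    (hg₀ : ∀ t : ℝ, g₀ (t : UnitAddCircle) = Complex.exp (-(2 * π * I * lam * ((tri (2 * π * N * t) / (2 * π * N) : ℝ) : ℂ))))
    (hg₀c : Continuous g₀) {E : ℕ} (hE : 2 ≤ E) (W : Finset ℤ) (hW : ∀ m ∈ W, (N : ℤ) * E ≤ |(|m| - |lam|)|) :
    ∑ m ∈ W, ‖fourierCoeff g₀ m‖ ^ 2 ≤ 6 / (π ^ 2 * ((E : ℝ) - 1)) := by
  classical
  have hπ : 0 < π := Real.pi_pos
  have hE' : (2 : ℝ) ≤ E := by exact_mod_cast hE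
  have hNE : (1 : ℤ) ≤ (N : ℤ) * E := by nlinarith [show (1 : ℤ) ≤ N by exact_mod_cast hN, show (2 : ℤ) ≤ E by exact_mod_cast hE]
  -- split `W` into the outside and inside parts
  set Wo := W.filter (fun m => |lam| + (N : ℤ) * E ≤ |m|) with hWo
  set Wi := W.filter (fun m => ¬ (|lam| + (N : ℤ) * E ≤ |m|)) with hWi
  have hsplit : ∑ m ∈ W, ‖fourierCoeff g₀ m‖ ^ 2 =
      ∑ m ∈ Wo, ‖fourierCoeff g₀ m‖ ^ 2 + ∑ m ∈ Wi, ‖fourierCoeff g₀ m‖ ^ 2 := by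
    rw [hWo, hWi, ← Finset.sum_filter_add_sum_filter_not W (fun m => |lam| + (N : ℤ) * E ≤ |m|)]
  -- outside part ≤ the outside series
  have hout : ∑ m ∈ Wo, ‖fourierCoeff g₀ m‖ ^ 2 ≤ 2 / (π ^ 2 * ((E : ℝ) - 1)) := by
    refine le_trans ?_ (tsum_outside_sq_norm_nTooth_le hN hL hg₀ hg₀c hE)
    have hs : Summable fun m : ℤ => (if |lam| + (N : ℤ) * E ≤ |m| then ‖fourierCoeff g₀ m‖ ^ 2 else 0) :=
      Summable.of_nonneg_of_le (fun m => by split_ifs <;> positivity)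
        (fun m => by split_ifs; exacts [le_rfl, sq_nonneg _]) (hasSum_sq_norm_fourierCoeff_nTooth hg₀ hg₀c).summable
    calc ∑ m ∈ Wo, ‖fourierCoeff g₀ m‖ ^ 2
        = ∑ m ∈ Wo, (if |lam| + (N : ℤ) * E ≤ |m| then ‖fourierCoeff g₀ m‖ ^ 2 else 0) :=
          Finset.sum_congr rfl fun m hm => by rw [hWo, Finset.mem_filter] at hm; rw [if_pos hm.2]
      _ ≤ ∑' m, (if |lam| + (N : ℤ) * E ≤ |m| then ‖fourierCoeff g₀ m‖ ^ 2 else 0) :=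
          hs.sum_le_tsum Wo fun m _ => by split_ifs <;> positivity
  -- inside part: empty unless `E ≤ |L|`, then inside the window `[-(|λ|−NE), |λ|−NE]`
  have hin : ∑ m ∈ Wi, ‖fourierCoeff g₀ m‖ ^ 2 ≤ 4 / (π ^ 2 * ((E : ℝ) - 1)) := by
    have hWisub : Wi ⊆ Finset.Icc (-(|lam| - (N : ℤ) * E)) (|lam| - (N : ℤ) * E) := by
      intro m hm
      rw [hWi, Finset.mem_filter] at hm
      have h1 := hW m hm.1
      have h2 := hm.2
      rw [Finset.mem_Icc, ← abs_le]
      rw [le_abs] at h1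
      omega
    by_cases hEL : (E : ℤ) ≤ |L|
    · exact (Finset.sum_le_sum_of_subset_of_nonneg hWisub fun _ _ _ => sq_nonneg _).trans
        (sum_inside_sq_norm_nTooth_le' hN hL hg₀ hE hEL)
    · have hempty : Wi = ∅ := by
        rw [Finset.eq_empty_iff_forall_notMem]
        intro m hm
        have h := hWisub hm
        rw [Finset.mem_Icc] at h
        have hlam : |lam| = (N : ℤ) * |L| := by rw [hL, abs_mul, Nat.abs_cast]
        have : (N : ℤ) * |L| < (N : ℤ) * E := by
          have hN1 : (0 : ℤ) < N := by exact_mod_cast hN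
          nlinarith
        omega
      rw [hempty, Finset.sum_empty]
      exact div_nonneg (by norm_num) (mul_nonneg (sq_nonneg _) (by linarith))
  rw [hsplit]
  have e : 6 / (π ^ 2 * ((E : ℝ) - 1)) = 2 / (π ^ 2 * ((E : ℝ) - 1)) + 4 / (π ^ 2 * ((E : ℝ) - 1)) := by
    field_simp; ring
  rw [e]; exact add_le_add hout hin

/-- **Off-lobe window mass of a ROUNDED chirp, with a source shift**: if `g = twist ψ n` is `η`-close in phase to the exact
chirp `g₀` (`|nψ − f| ≤ η`, `g₀ = e^{−2πif}` of `N`-tooth type with lobes `±λ`, `λ = N·L`), `|q'| ≤ Q`, `E ≥ 2`, and the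
window `W` satisfies `NE + Q ≤ ||m| − |λ||` on `W`, then `Σ_{m∈W} ‖ĝ(m−q')‖² ≤ (√(6/(π²(E−1))) + 2πη)²`.
[cite: Grafakos2014, Prop. 3.1.2 (5), Prop. 3.2.7 (3)] -/
theorem sum_offLobe_window_sq_norm_twist_le (ψ : ShearProfile) (n : ℤ) {N : ℕ} (hN : 0 < N) {lam L : ℤ} (hL : lam = N * L)
    {g₀ : UnitAddCircle → ℂ}
    (hg₀ : ∀ t : ℝ, g₀ (t : UnitAddCircle) = Complex.exp (-(2 * π * I * lam * ((tri (2 * π * N * t) / (2 * π * N) : ℝ) : ℂ))))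
    (hg₀c : Continuous g₀) {η : ℝ} (hη : ∀ t : ℝ, |n * ψ t - lam * (tri (2 * π * N * t) / (2 * π * N))| ≤ η)
    {E Q : ℕ} (hE : 2 ≤ E) {q' : ℤ} (hq' : |q'| ≤ Q) (W : Finset ℤ)
    (hW : ∀ m ∈ W, (N : ℤ) * E + Q ≤ |(|m| - |lam|)|) :
    ∑ m ∈ W, ‖fourierCoeff (twist ψ n) (m - q')‖ ^ 2 ≤ (Real.sqrt (6 / (π ^ 2 * ((E : ℝ) - 1))) + 2 * π * η) ^ 2 := by
  classical
  have hπ : 0 < π := Real.pi_pos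
  have hη0 : 0 ≤ η := (abs_nonneg _).trans (hη 0)
  have hg₀' : ∀ t : ℝ, g₀ (t : UnitAddCircle) = cexp (-(2 * π * I * (((lam * (tri (2 * π * N * t) / (2 * π * N)) : ℝ) : ℂ)))) := by
    intro t; rw [hg₀ t]; push_cast; ring_nf
  have h1 := sqrt_window_shift_twist_le ψ n q' hg₀' hg₀c hη W
  -- the shifted exact window is off-lobe at distance `≥ NE`
  have h2 : ∑ m ∈ W, ‖fourierCoeff g₀ (m - q')‖ ^ 2 ≤ 6 / (π ^ 2 * ((E : ℝ) - 1)) := by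
    rw [← Finset.sum_image (f := fun m : ℤ => ‖fourierCoeff g₀ m‖ ^ 2) (s := W) (g := fun m => m - q')
      fun a _ b _ h => by simpa using h]
    refine sum_offLobe_window_sq_norm_nTooth_le hN hL hg₀ hg₀c hE _ fun m hm => ?_
    rw [Finset.mem_image] at hm
    obtain ⟨m₀, hm₀, rfl⟩ := hm
    have h := hW m₀ hm₀
    have hq1 := abs_le.1 hq'
    have t1 : |(|m₀ - q'| - |lam|)| ≥ |(|m₀| - |lam|)| - |q'| := by
      have h3 : |(|m₀ - q'| - |lam| - (|m₀| - |lam|))| ≤ |q'| := by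
        rw [show |m₀ - q'| - |lam| - (|m₀| - |lam|) = |m₀ - q'| - |m₀| by ring]
        have := abs_abs_sub_abs_le (m₀ - q') m₀
        rw [show m₀ - q' - m₀ = -q' by ring, abs_neg] at this
        exact this
      have h4 := abs_sub_abs_le_abs_sub (|m₀| - |lam|) (|m₀ - q'| - |lam|)
      rw [show |m₀| - |lam| - (|m₀ - q'| - |lam|) = -(|m₀ - q'| - |lam| - (|m₀| - |lam|)) by ring, abs_neg] at h4
      linarith
    linarith
  have h3 : Real.sqrt (∑ m ∈ W, ‖fourierCoeff (twist ψ n) (m - q')‖ ^ 2) ≤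
      Real.sqrt (6 / (π ^ 2 * ((E : ℝ) - 1))) + 2 * π * η :=
    h1.trans (add_le_add (Real.sqrt_le_sqrt h2) le_rfl)
  have h0 : 0 ≤ ∑ m ∈ W, ‖fourierCoeff (twist ψ n) (m - q')‖ ^ 2 := Finset.sum_nonneg fun _ _ => sq_nonneg _
  calc ∑ m ∈ W, ‖fourierCoeff (twist ψ n) (m - q')‖ ^ 2
      = Real.sqrt (∑ m ∈ W, ‖fourierCoeff (twist ψ n) (m - q')‖ ^ 2) ^ 2 := (Real.sq_sqrt h0).symm
    _ ≤ (Real.sqrt (6 / (π ^ 2 * ((E : ℝ) - 1))) + 2 * π * η) ^ 2 :=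
        pow_le_pow_left₀ (Real.sqrt_nonneg _) h3 2

end Summit.AnomalousDissipation.AnomalousDissipation.Theorems.SawtoothPulseCascade.K1Window
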